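import Summits.AnomalousDissipation.AnomalousDissipation.Theorems.TwoAndHalfDTwohalfdNegCertificate
import Summits.AnomalousDissipation.AnomalousDissipation.Theorems.TwoAndHalfDTwohalfdNegQuietOfSubLog
import Summits.AnomalousDissipation.AnomalousDissipation.Theorems.TwoAndHalfDScalarLiftGlue
import Literature.Analysis.FluidPDE.TwoHalfSpectralSplit
import Literature.Analysis.FluidPDE.LerayHopfMomentum
import Literature.Analysis.FluidPDE.LerayHopfSpectralMeasurability
import Literature.Analysis.FluidPDE.LongTimeAverageSubadditive

/-!
# The crux `TwoAndHalfD.TwohalfdNeg` (stmt-AnomalousDissipation-0211) on the Batchelor branch: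
# an `x₃`-invariant family with sub-logarithmic mean strain carries no zeroth law

The line `log-kantorovich-enstrophy-transfer` reduces the crux to the planar law S6
(`stub_subLogStrain`, open).  Its engine proves more locally: the crux holds for every single
family whose OWN `limsup`-mean strain is sub-logarithmic — stated here on the crux's objects
(three-dimensional `x₃`-invariant Leray–Hopf families), with no hypothesis on other families and
none on the force beyond the crux's.

* `longTimeAvgSup_mono_ae` — monotonicity of `limsup` Cesàro means under an a.e. pointwise bound
  (the everywhere version is `Literature.Analysis.FluidPDE.longTimeAvgSup_mono`; the running-mean
  step is the tree's `Theorems.timeMean_mono_ae`).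
* `longTimeAvgSup_sqrt_eGradNormSq_section_le` — along a global Leray–Hopf solution `u` on `T³`
  with a steady mean-zero `L²` force whose sections off `t = 0` are `twoHalf (v t) (θ t)`, the
  `limsup`-mean planar strain is at most the three-dimensional one,
  `⟨√‖∇v‖²⟩ ≤ ⟨√‖∇u‖²⟩` (spectral split `‖∇(V,R)∘π‖² = ‖∇V‖² + ‖∇R‖²` at the a.e. times where
  `‖∇u(t)‖² < ∞`; the running means of `√‖∇u‖²` are bounded,
  `QuietOfSubLog.isBoundedUnder_timeMean_sqrt_eGradNormSq`, Doering–Foias).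
* `twohalfdNeg_family_of_subLogStrain` — **the crux on the Batchelor branch**: for every
  `x₃`-invariant steady smooth divergence-free mean-zero `f`, `ν_j → 0`, and every bounded-energy
  family of `x₃`-invariant global Leray–Hopf solutions with
  `⟨√‖∇u_j‖²⟩ / log(1/ν_j) → 0`: `meanDissipation (ν j) (u j) → 0` (reduction S1' + S2 + S4 ⇒ S5'
  ⇒ S3' applied to the planar section, whose strain is sub-logarithmic by the comparison).
* `not_subLogStrain_of_dissipationFloor` — contrapositive, the shape of every `X`-witness: an
  admissible family with a `j`-uniform dissipation floor `ε > 0` has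
  `¬ (⟨√‖∇u_j‖²⟩ / log(1/ν_j) → 0)` — its mean strain is at least logarithmic along a subsequence
  (the three-dimensional form of the sibling files `TwohalfdThesisStubStrainGate` / `SubLogKillsW`,
  here for arbitrary Leray–Hopf families rather than released classical templates).

The file closes with the registered tools stub `stub_subLogFamily`.  Supports stmt-AnomalousDissipation-0211.
-/

namespace Summit.AnomalousDissipation.AnomalousDissipation.Theorems.TwohalfdNeg.SubLogFamily

open MeasureTheory Filter Topology Set
open scoped ENNReal NNReal
open Literature.Analysis.FunctionSpaces Literature.Analysis.FluidPDE
open Summit.AnomalousDissipation.AnomalousDissipation.Theorems.TwohalfdNeg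

set_option linter.dupNamespace false

/-! ## Means under an a.e. bound -/

/-- **Monotonicity of the long-time average under an a.e. bound**: `⟨u⟩ ≤ ⟨g⟩` whenever
`u ≥ 0` everywhere, `u ≤ g` a.e. on `(0, ∞)`, `g ≥ 0` is integrable on every `(0, T]` and its
running means are eventually bounded. [folklore] -/
theorem longTimeAvgSup_mono_ae {u g : ℝ → ℝ} (hu0 : ∀ t, 0 ≤ u t) (hg0 : ∀ t, 0 ≤ g t)
    (hgi : ∀ T, 0 < T → IntegrableOn g (Ioc 0 T))
    (hle : ∀ᵐ t ∂(volume.restrict (Ioi 0)), u t ≤ g t)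
    (hb : IsBoundedUnder (· ≤ ·) atTop (timeMean g)) :
    longTimeAvgSup u ≤ longTimeAvgSup g := by
  unfold longTimeAvgSup
  refine limsup_le_limsup ?_ (isCoboundedUnder_le_timeMean_of_nonneg hu0) hb
  filter_upwards [eventually_gt_atTop (0 : ℝ)] with T hT
  exact Summit.AnomalousDissipation.AnomalousDissipation.Theorems.timeMean_mono_ae hT.le hg0 (hgi T hT)
    (ae_restrict_of_ae_restrict_of_subset Ioc_subset_Ioi_self hle)

/-! ## The planar strain of the sections is dominated by the three-dimensional strain -/

section Strain

variable {ν : ℝ} {f u₀ : UnitAddTorus (Fin 3) → EuclideanSpace ℝ (Fin 3)}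
  {u : ℝ → UnitAddTorus (Fin 3) → EuclideanSpace ℝ (Fin 3)}

/-- The strain observable `t ↦ √‖∇u(t)‖₂²` of a global Leray–Hopf solution with a steady `L²`
force is integrable on every `(0, T]` (`√x ≤ 1 + x` and `∫₀ᵀ‖∇u‖² < ∞`). [folklore] -/
theorem integrableOn_sqrt_eGradNormSq (hν : 0 < ν) (hu : Torus.IsGlobalLerayHopf ν (fun _ => f) u₀ u)
    {T : ℝ} (hT : 0 < T) :
    IntegrableOn (fun t => Real.sqrt (Torus.eGradNormSq (u t)).toReal) (Ioc 0 T) := by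
  have H := hu T hT
  have hF : IntegrableOn (fun t => (Torus.eGradNormSq (u t)).toReal) (Ioc 0 T) := by
    have h := ReductionOffZero.integrableOn_dissipation hu hT
    have h' := h.const_mul ν⁻¹
    refine h'.congr ?_
    filter_upwards with t
    show ν⁻¹ * (ν * (Torus.eGradNormSq (u t)).toReal) = (Torus.eGradNormSq (u t)).toReal
    rw [← mul_assoc, inv_mul_cancel₀ hν.ne', one_mul]
  have hG : IntegrableOn (fun t => 1 + (Torus.eGradNormSq (u t)).toReal) (Ioc 0 T) :=
    (integrableOn_const (hs := measure_Ioc_lt_top.ne)).add hF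
  refine Integrable.mono' hG (Real.continuous_sqrt.comp_aestronglyMeasurable hF.aestronglyMeasurable) ?_
  filter_upwards with t
  rw [Real.norm_eq_abs, abs_of_nonneg (Real.sqrt_nonneg _)]
  have hx : (0 : ℝ) ≤ (Torus.eGradNormSq (u t)).toReal := ENNReal.toReal_nonneg
  calc Real.sqrt (Torus.eGradNormSq (u t)).toReal
      ≤ Real.sqrt ((1 + (Torus.eGradNormSq (u t)).toReal) ^ 2) := Real.sqrt_le_sqrt (by nlinarith)
    _ = 1 + (Torus.eGradNormSq (u t)).toReal := Real.sqrt_sq (by linarith)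

/-- Off `t = 0`, at every time where the three-dimensional strain is finite, the planar strain
of the section is dominated: `√‖∇v(t)‖² ≤ √‖∇u(t)‖²` for `u t = twoHalf (v t) (θ t)`, `t > 0`
(`‖∇(V,R)∘π‖² = ‖∇V‖² + ‖∇R‖²`, `TwoHalfSpectralSplit`); a.e. on `(0, ∞)` along a global
Leray–Hopf solution. [folklore] -/
theorem ae_sqrt_eGradNormSq_section_le (hu : Torus.IsGlobalLerayHopf ν (fun _ => f) u₀ u)
    {v : ℝ → UnitAddTorus (Fin 2) → EuclideanSpace ℝ (Fin 2)} {θ : ℝ → UnitAddTorus (Fin 2) → ℝ}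
    (hsec : ∀ t : ℝ, t ≠ 0 → u t = Torus.twoHalf (v t) (θ t)) :
    ∀ᵐ t ∂(volume.restrict (Ioi 0)),
      Real.sqrt (Torus.eGradNormSq (v t)).toReal ≤ Real.sqrt (Torus.eGradNormSq (u t)).toReal := by
  -- a.e. finiteness of the strain on `(0, ∞) = ⋃ₙ (0, n+1)`
  have hcover : Ioi (0 : ℝ) = ⋃ n : ℕ, Ioo (0 : ℝ) ((n : ℝ) + 1) := by
    ext t
    simp only [mem_Ioi, mem_iUnion, mem_Ioo]
    constructor
    · intro ht
      obtain ⟨n, hn⟩ := exists_nat_gt t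
      exact ⟨n, ht, by linarith⟩
    · rintro ⟨n, ht, -⟩
      exact ht
  have hfin : ∀ᵐ t ∂(volume.restrict (Ioi 0)), Torus.eGradNormSq (u t) < ⊤ := by
    rw [hcover, ae_restrict_iUnion_iff]
    intro n
    have H := hu ((n : ℝ) + 1) (by positivity)
    exact ae_lt_top' H.aemeasurable_eGradNormSq H.lintegral_eGradNormSq_lt_top.ne
  filter_upwards [hfin, ae_restrict_mem measurableSet_Ioi] with t ht htpos
  have hmem : MemLp (u t) 2 volume := (hu t htpos).memLp t ⟨le_of_lt htpos, le_rfl⟩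
  rw [hsec t (ne_of_gt htpos)] at hmem ht ⊢
  obtain ⟨hV, hR⟩ := Literature.Analysis.FluidPDE.Torus.memLp_of_twoHalf hmem
  have hle : Torus.eGradNormSq (v t) ≤ Torus.eGradNormSq (Torus.twoHalf (v t) (θ t)) :=
    Literature.Analysis.FluidPDE.Torus.eGradNormSq_left_le_twoHalf (hV.integrable one_le_two)
      (hR.integrable one_le_two)
  exact Real.sqrt_le_sqrt (ENNReal.toReal_mono ht.ne hle)

/-- **The `limsup`-mean planar strain of the sections is at most the three-dimensional one.**
Along a global Leray–Hopf solution `u` on `T³` (steady mean-zero force `f ∈ L²`, `ν > 0`) whose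
sections off `t = 0` are `u t = twoHalf (v t) (θ t)`:
`⟨√‖∇v‖²⟩ ≤ ⟨√‖∇u‖²⟩` (`longTimeAvgSup`). [folklore] -/
theorem longTimeAvgSup_sqrt_eGradNormSq_section_le (hν : 0 < ν) (hf : MemLp f 2 volume)
    (hf0 : Torus.HasZeroMean f) (hu : Torus.IsGlobalLerayHopf ν (fun _ => f) u₀ u)
    {v : ℝ → UnitAddTorus (Fin 2) → EuclideanSpace ℝ (Fin 2)} {θ : ℝ → UnitAddTorus (Fin 2) → ℝ}
    (hsec : ∀ t : ℝ, t ≠ 0 → u t = Torus.twoHalf (v t) (θ t)) :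
    longTimeAvgSup (fun t => Real.sqrt (Torus.eGradNormSq (v t)).toReal) ≤
      longTimeAvgSup (fun t => Real.sqrt (Torus.eGradNormSq (u t)).toReal) :=
  longTimeAvgSup_mono_ae (fun _ => Real.sqrt_nonneg _) (fun _ => Real.sqrt_nonneg _)
    (fun _ hT => integrableOn_sqrt_eGradNormSq hν hu hT) (ae_sqrt_eGradNormSq_section_le hu hsec)
    (QuietOfSubLog.isBoundedUnder_timeMean_sqrt_eGradNormSq hu hν hf hf0)

end Strain

/-! ## The crux on the Batchelor branch -/

/-- **`TwohalfdNeg` for every family with sub-logarithmic mean strain.** For every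
`x₃`-invariant steady smooth divergence-free mean-zero force `f` on `T³`, every `ν_j > 0` with
`ν_j → 0`, and every family of `x₃`-invariant global Leray–Hopf solutions `u_j` of NS_{ν_j} forced
by `f` from arbitrary `L²` data with `ν`-uniformly bounded `limsup`-mean energy AND
sub-logarithmic `limsup`-mean strain, `⟨√‖∇u_j‖²⟩ / log(1/ν_j) → 0`: `meanDissipation (ν j) (u j) → 0`.
Proof: reduction S1' (`stub_reductionOffZero`), planar dissipation `→ 0` (S2), the section's strain
is sub-logarithmic (`longTimeAvgSup_sqrt_eGradNormSq_section_le`, squeeze past the rank where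
`ν_j < 1`), so the sourced scalar's dissipation `→ 0` (S4 ⇒ S5' ⇒ S3'), and the dissipation
sub-splits. [folklore] -/
theorem twohalfdNeg_family_of_subLogStrain :
    ∀ f : UnitAddTorus (Fin 3) → EuclideanSpace ℝ (Fin 3),
      (∀ (s : UnitAddCircle) (x : UnitAddTorus (Fin 3)), f (x + Pi.single (2 : Fin 3) s) = f x) →
      Torus.IsSmooth f → Torus.IsDivFree f → Torus.HasZeroMean f →
      ∀ (ν : ℕ → ℝ) (u₀ : ℕ → UnitAddTorus (Fin 3) → EuclideanSpace ℝ (Fin 3))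
        (u : ℕ → ℝ → UnitAddTorus (Fin 3) → EuclideanSpace ℝ (Fin 3)),
        (∀ j, 0 < ν j) → Tendsto ν atTop (𝓝 0) →
        (∀ j, Torus.IsGlobalLerayHopf (ν j) (fun _ => f) (u₀ j) (u j)) →
        (∀ j (t : ℝ) (s : UnitAddCircle) (x : UnitAddTorus (Fin 3)),
          u j t (x + Pi.single (2 : Fin 3) s) = u j t x) →
        (∃ E : ℝ, ∀ j, meanEnergy (u j) ≤ E) →
        Tendsto (fun j => longTimeAvgSup (fun t => Real.sqrt (Torus.eGradNormSq (u j t)).toReal) /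
          Real.log (ν j)⁻¹) atTop (𝓝 0) →
        Tendsto (fun j => meanDissipation (ν j) (u j)) atTop (𝓝 0) := by
  intro f hfinv hfs hfd hfz ν u₀ u hν hν0 hLH huinv hE hsubu
  obtain ⟨g, h, v₀, v, θ₀, θ, hgs, hgd, hgz, hhs, hhz, -, hsec, hvLH, hθ₀, hθw, hEv, hEθ, hsplit⟩ :=
    ReductionOffZero.stub_reductionOffZero f hfinv hfs hfd hfz ν u₀ u hν hLH huinv hE
  have hplanar : Tendsto (fun j => meanDissipation (ν j) (v j)) atTop (𝓝 0) :=
    PlanarNoAnomaly.stub_planarNoAnomaly g hgs hgd hgz ν v₀ v hν hν0 hvLH hEv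
  -- the section's strain is sub-logarithmic
  have hfL2 : MemLp f 2 volume := hfs.memLp 2
  have hcmp : ∀ j, longTimeAvgSup (fun t => Real.sqrt (Torus.eGradNormSq (v j t)).toReal) ≤
      longTimeAvgSup (fun t => Real.sqrt (Torus.eGradNormSq (u j t)).toReal) := fun j =>
    longTimeAvgSup_sqrt_eGradNormSq_section_le (hν j) hfL2 hfz (hLH j) (hsec j)
  have hν1 : ∀ᶠ j in atTop, ν j < 1 := hν0.eventually (gt_mem_nhds one_pos)
  have hsub : Tendsto (fun j => longTimeAvgSup (fun t => Real.sqrt (Torus.eGradNormSq (v j t)).toReal) /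
      Real.log (ν j)⁻¹) atTop (𝓝 0) := by
    refine squeeze_zero' ?_ ?_ hsubu
    · filter_upwards [hν1] with j hj
      exact div_nonneg (longTimeAvgSup_nonneg fun _ => Real.sqrt_nonneg _)
        (Real.log_nonneg ((one_le_inv₀ (hν j)).2 hj.le))
    · filter_upwards [hν1] with j hj
      exact div_le_div_of_nonneg_right (hcmp j) (Real.log_nonneg ((one_le_inv₀ (hν j)).2 hj.le))
  have hquiet := QuietOfSubLogGrid.stub_quietOfSubLogGrid
    (ReleaseLogBound.stub_releaseLogBound (d := Fin 2)) g hgs hgd hgz ν v₀ v hν hν0 hvLH hEv hsub h hhs hhz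
  have hscalar : Tendsto (fun j => longTimeAvgSup
      (fun t => ν j * (Torus.eScalarGradNormSq (θ j t)).toReal)) atTop (𝓝 0) :=
    AgeDecouplingGrid.stub_ageDecouplingGrid g h hgs hgd hgz hhs hhz ν v₀ v θ₀ θ hν hvLH hEv hθ₀ hθw
      hEθ hquiet
  have hsum : Tendsto (fun j => meanDissipation (ν j) (v j) +
      longTimeAvgSup (fun t => ν j * (Torus.eScalarGradNormSq (θ j t)).toReal)) atTop (𝓝 0) := by
    simpa using hplanar.add hscalar
  exact squeeze_zero (fun j => meanDissipation_nonneg (hν j).le (u j)) hsplit hsum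

/-- **The shape of an `X`-witness: at least logarithmic mean strain.** An `x₃`-invariant
bounded-energy global Leray–Hopf family under an `x₃`-invariant steady smooth force with a
`j`-uniform floor `ε > 0` under its mean dissipation does NOT have sub-logarithmic mean strain:
`¬ (⟨√‖∇u_j‖²⟩ / log(1/ν_j) → 0)`. [folklore] -/
theorem not_subLogStrain_of_dissipationFloor :
    ∀ f : UnitAddTorus (Fin 3) → EuclideanSpace ℝ (Fin 3),
      (∀ (s : UnitAddCircle) (x : UnitAddTorus (Fin 3)), f (x + Pi.single (2 : Fin 3) s) = f x) →
      Torus.IsSmooth f → Torus.IsDivFree f → Torus.HasZeroMean f →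
      ∀ (ν : ℕ → ℝ) (u₀ : ℕ → UnitAddTorus (Fin 3) → EuclideanSpace ℝ (Fin 3))
        (u : ℕ → ℝ → UnitAddTorus (Fin 3) → EuclideanSpace ℝ (Fin 3)),
        (∀ j, 0 < ν j) → Tendsto ν atTop (𝓝 0) →
        (∀ j, Torus.IsGlobalLerayHopf (ν j) (fun _ => f) (u₀ j) (u j)) →
        (∀ j (t : ℝ) (s : UnitAddCircle) (x : UnitAddTorus (Fin 3)),
          u j t (x + Pi.single (2 : Fin 3) s) = u j t x) →
        (∃ E : ℝ, ∀ j, meanEnergy (u j) ≤ E) →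
        (∃ ε : ℝ, 0 < ε ∧ ∀ j, ε ≤ meanDissipation (ν j) (u j)) →
        ¬ Tendsto (fun j => longTimeAvgSup (fun t => Real.sqrt (Torus.eGradNormSq (u j t)).toReal) /
          Real.log (ν j)⁻¹) atTop (𝓝 0) := by
  intro f hfinv hfs hfd hfz ν u₀ u hν hν0 hLH huinv hE ⟨ε, hε, hεj⟩ hsubu
  have ht := twohalfdNeg_family_of_subLogStrain f hfinv hfs hfd hfz ν u₀ u hν hν0 hLH huinv hE hsubu
  obtain ⟨j, hj⟩ := (ht.eventually (gt_mem_nhds hε)).exists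
  exact (not_lt.2 (hεj j)) hj


/-- **Registered tools stub `stub_subLogFamily`** (conjunction of the two theorems of this file,
registered on stmt-AnomalousDissipation-0211 with `ledger workitem stub-add`): the crux on the
Batchelor branch and the witness shape. [folklore] -/
theorem stub_subLogFamily :
    (∀ f : UnitAddTorus (Fin 3) → EuclideanSpace ℝ (Fin 3), (∀ (s : UnitAddCircle) (x : UnitAddTorus (Fin 3)), f (x + Pi.single (2 : Fin 3) s) = f x) → Torus.IsSmooth f → Torus.IsDivFree f → Torus.HasZeroMean f → ∀ (ν : ℕ → ℝ) (u₀ : ℕ → UnitAddTorus (Fin 3) → EuclideanSpace ℝ (Fin 3)) (u : ℕ → ℝ → UnitAddTorus (Fin 3) → EuclideanSpace ℝ (Fin 3)), (∀ j, 0 < ν j) → Tendsto ν atTop (𝓝 0) → (∀ j, Torus.IsGlobalLerayHopf (ν j) (fun _ => f) (u₀ j) (u j)) → (∀ j (t : ℝ) (s : UnitAddCircle) (x : UnitAddTorus (Fin 3)), u j t (x + Pi.single (2 : Fin 3) s) = u j t x) → (∃ E : ℝ, ∀ j, meanEnergy (u j) ≤ E) → Tendsto (fun j => longTimeAvgSup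 (fun t => Real.sqrt (Torus.eGradNormSq (u j t)).toReal) / Real.log (ν j)⁻¹) atTop (𝓝 0) → Tendsto (fun j => meanDissipation (ν j) (u j)) atTop (𝓝 0)) ∧ (∀ f : UnitAddTorus (Fin 3) → EuclideanSpace ℝ (Fin 3), (∀ (s : UnitAddCircle) (x : UnitAddTorus (Fin 3)), f (x + Pi.single (2 : Fin 3) s) = f x) → Torus.IsSmooth f → Torus.IsDivFree f → Torus.HasZeroMean f → ∀ (ν : ℕ → ℝ) (u₀ : ℕ → UnitAddTorus (Fin 3) → EuclideanSpace ℝ (Fin 3)) (u : ℕ → ℝ → UnitAddTorus (Fin 3) → EuclideanSpace ℝ (Fin 3)), (∀ j, 0 < ν j) → Tendsto ν atTop (𝓝 0) → (∀ j, Torus.IsGlobalLerayHopf (ν j) (fun _ => f) (u₀ j) (u j)) → (∀ j (t : ℝ) (s : UnitAddCircle) (x : UnitAddTorus (Fin 3)), u j t (x + Pi.single (2 : Fin 3) s) = u j t x) → (∃ E : ℝ, ∀ j, meanEnergy (u j) ≤ E) → (∃ ε : ℝ, 0 < ε ∧ ∀ j, ε ≤ meanDissipation (ν j) (u j)) → ¬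 Tendsto (fun j => longTimeAvgSup (fun t => Real.sqrt (Torus.eGradNormSq (u j t)).toReal) / Real.log (ν j)⁻¹) atTop (𝓝 0)) :=
  ⟨twohalfdNeg_family_of_subLogStrain, not_subLogStrain_of_dissipationFloor⟩

end Summit.AnomalousDissipation.AnomalousDissipation.Theorems.TwohalfdNeg.SubLogFamily
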